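import Literature.NumberTheory.LFunctions.LandauDirichletSeries
import HarnessLib

/-!
# Landau's theorem on Dirichlet series with non-negative coefficients: local and quotient forms

Topic `Literature/NumberTheory/LFunctions`; namespace `Literature.NumberTheory.LFunctions.Landau`.
Sequel to `LandauDirichletSeries` (Montgomery–Vaughan, *Multiplicative Number Theory I*, §1.2,
Thm. 1.7: the abscissa `σ_c` of a Dirichlet series `∑ a_n n^{-s}` with `a_n ≥ 0` is a singular
point), which proves the disc form, the half-plane form and the *exponential half-plane form*
`abscissaOfAbsConv_le_of_exp_eq` (if `exp (∑ a_n n^{-s})` continues to a function holomorphic on a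
half-plane `re s > y`, the series converges absolutely there). The exponential form is the shape
in which Landau's theorem is applied to Euler products with non-negative Dirichlet coefficients,
e.g. `L_S(s, π × π̄) = exp ∑_{v, k} |tr A_v^k|² q_v^{-ks} / k` in Jacquet–Shalika, *On Euler
products and the classification of automorphic representations I*, Amer. J. Math. **103** (1981),
proof of Thm. (5.3), p. 556.

This file records the observation that **only the real axis matters** in that application, in
three proved statements (no definition, no named fact):

* `abscissaOfAbsConv_lt_of_exp_eq_on_ball` — **exponential disc form**: if `a_n ≥ 0`, the
  abscissa is `≤ x`, and a function `F` holomorphic on a disc `|s - x| < ε` satisfies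
  `F = exp (LSeries a)` on the part of the disc with `re s > x`, then the abscissa is `< x`
  (`F(x) ≥ 1` by monotonicity along the real axis, so `log F` is holomorphic near `x` and
  continues the series itself; then the disc form `abscissaOfAbsConv_lt_of_differentiableOn_ball`);
* `abscissaOfAbsConv_le_of_exp_eq_nhds` — **real-axis form**: if for every real `c > y` which
  bounds the abscissa from above some function holomorphic on a disc about `c` agrees with
  `exp (LSeries a)` right of `c`, then the abscissa is `≤ y`;
* `abscissaOfAbsConv_le_of_exp_quotient` — **quotient form**: if for every real `σ₀ > y` there are
  functions `I`, `A` holomorphic on the half-plane `re s > y` with `A(σ₀) ≠ 0` and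
  `I = A · exp (LSeries a)` on a right half-plane `re s > x₀`, then the abscissa is `≤ y`. Here the
  quotient `I / A` continues `exp (LSeries a)` only to a neighbourhood of the real point `σ₀`
  (where `A ≠ 0`), which by the real-axis form is all that Landau's theorem consumes.

The quotient form is exactly what a Rankin–Selberg "basic identity" delivers at real points:
`I(s) = A(s) L_S(s, π × π̄)` with `I` a global integral holomorphic on `re s > 1` and `A(s)` a finite
product of local integrals, non-zero at a *real* `σ₀ > 1` by positivity — without the finer
local non-vanishing results needed at complex points (Jacquet–Shalika (1981), p. 555: "given `s₀`
we may choose the data so that `A(s₀) ≠ 0`"); see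
`Literature.NumberTheory.Automorphic.JacquetShalikaLargeFinset`.

## References

* H. L. Montgomery, R. C. Vaughan, *Multiplicative Number Theory I. Classical Theory*, CUP 2007,
  §1.2, Thm. 1.7 [MontgomeryVaughan2007].
* H. Jacquet, J. A. Shalika, Amer. J. Math. 103 (1981), 499–558, proof of Thm. (5.3), p. 556, and
  proof of Lemma (5.2), p. 555 [JacquetShalikaAJM1981].
-/

noncomputable section

open Complex LSeries Filter Topology Metric
open scoped ComplexOrder

namespace Literature.NumberTheory.LFunctions.Landau

/-- **Landau's theorem, exponential disc form.** Let `a n ≥ 0` with `abscissaOfAbsConv a ≤ x`,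
and let `F` be holomorphic on the disc `|s - x| < ε` with `F s = exp (LSeries a s)` for `s` in the
disc with `re s > x`. Then `abscissaOfAbsConv a < x`. Printed argument (Jacquet–Shalika (1981),
p. 556, on top of Montgomery–Vaughan Thm. 1.7): for real `σ ↓ x` the sums `∑ a_n n^{-σ} ≥ 0`, so
`F(σ) = exp (…) ≥ 1` and `F(x) ≥ 1 ≠ 0` by continuity; hence `log F` is holomorphic on a small
disc about `x`, where it continues the series (same derivative `F'/F` right of `x`, same value at
a real point), contradicting the disc form of Landau's theorem if the abscissa were `x`.
[cite: MontgomeryVaughan2007, §1.2, Thm. 1.7] -/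
theorem abscissaOfAbsConv_lt_of_exp_eq_on_ball {a : ℕ → ℂ} (ha : 0 ≤ a) {x ε : ℝ} (hε : 0 < ε)
    (hax : abscissaOfAbsConv a ≤ x) {F : ℂ → ℂ} (hF : DifferentiableOn ℂ F (ball (x : ℂ) ε))
    (heq : ∀ s ∈ ball (x : ℂ) ε, x < s.re → F s = Complex.exp (LSeries a s)) :
    abscissaOfAbsConv a < x := by
  have hU : IsOpen {s : ℂ | x < s.re} := isOpen_lt continuous_const continuous_re
  have hLan : AnalyticOnNhd ℂ (LSeries a) {s : ℂ | x < s.re} :=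
    (LSeries_analyticOnNhd a).mono fun s (hs : x < s.re) =>
      show abscissaOfAbsConv a < s.re from hax.trans_lt (by exact_mod_cast hs)
  -- (1) `F x ≥ 1`, in particular `F x` lies in the slit plane
  have hxball : (x : ℂ) ∈ ball (x : ℂ) ε := mem_ball_self hε
  have hcont : ContinuousAt F x := (hF.differentiableAt (isOpen_ball.mem_nhds hxball)).continuousAt
  have hnonneg : ∀ σ : ℝ, 0 ≤ LSeries a σ := fun σ => tsum_nonneg fun n => term_nonneg (ha n) σ
  have hFx : (1 : ℂ) ≤ F x := by
    have ht : Tendsto (fun σ : ℝ => F σ) (𝓝[>] x) (𝓝 (F x)) :=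
      (hcont.tendsto.comp (continuous_ofReal.tendsto x)).mono_left nhdsWithin_le_nhds
    have hnear : ∀ᶠ σ : ℝ in 𝓝[>] x, (σ : ℂ) ∈ ball (x : ℂ) ε ∧ σ ∈ Set.Ioi x := by
      refine Filter.Eventually.and ?_ eventually_mem_nhdsWithin
      exact Filter.Eventually.filter_mono nhdsWithin_le_nhds
        (continuous_ofReal.continuousAt.preimage_mem_nhds (isOpen_ball.mem_nhds hxball))
    refine ge_of_tendsto ht (hnear.mono fun σ hσ => ?_)
    have hσx : x < (σ : ℂ).re := by rw [ofReal_re]; exact hσ.2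
    rw [heq σ hσ.1 hσx, eq_re_of_ofReal_le (hnonneg σ), ← ofReal_exp, ← ofReal_one, real_le_real]
    refine Real.one_le_exp ?_
    have := (Complex.le_def.mp (hnonneg σ)).1
    simpa using this
  have hFx' : F x ∈ slitPlane := by
    refine mem_slitPlane_iff.mpr (Or.inl ?_)
    have := (Complex.le_def.mp hFx).1
    rw [one_re] at this
    linarith
  -- (2) a smaller disc about `x` on which `F` stays in the slit plane
  obtain ⟨δ, hδ, hball⟩ : ∃ δ > 0, ball (x : ℂ) δ ⊆ ball (x : ℂ) ε ∩ F ⁻¹' slitPlane :=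
    Metric.mem_nhds_iff.mp (Filter.inter_mem (isOpen_ball.mem_nhds hxball)
      (hcont.preimage_mem_nhds (isOpen_slitPlane.mem_nhds hFx')))
  -- (3) `log F` is holomorphic on the small disc ...
  have hh : DifferentiableOn ℂ (fun s => Complex.log (F s)) (ball (x : ℂ) δ) :=
    (hF.mono fun s hs => (hball hs).1).clog fun s hs => (hball hs).2
  -- (4) ... and agrees with `LSeries a` on the part of the small disc right of `x`
  have hagree : ∀ s ∈ ball (x : ℂ) δ, x < s.re → Complex.log (F s) = LSeries a s := by
    have hVo : IsOpen (ball (x : ℂ) δ ∩ {s : ℂ | x < s.re}) := isOpen_ball.inter hU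
    have hVc : IsPreconnected (ball (x : ℂ) δ ∩ {s : ℂ | x < s.re}) :=
      ((convex_ball _ _).inter (convex_halfSpace_re_gt x)).isPreconnected
    have hσ₀ : ((x + δ / 2 : ℝ) : ℂ) ∈ ball (x : ℂ) δ ∩ {s : ℂ | x < s.re} := by
      refine ⟨?_, ?_⟩
      · rw [mem_ball, dist_eq, ← ofReal_sub, norm_real, Real.norm_eq_abs,
          show x + δ / 2 - x = δ / 2 by ring, abs_of_pos (by positivity)]
        linarith
      · show x < ((x + δ / 2 : ℝ) : ℂ).re
        rw [ofReal_re]; linarith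
    have hderivEq : (ball (x : ℂ) δ ∩ {s : ℂ | x < s.re}).EqOn
        (deriv fun s => Complex.log (F s)) (deriv (LSeries a)) := by
      intro s hs
      have hsU : x < s.re := hs.2
      have habs : abscissaOfAbsConv a < s.re := hax.trans_lt (by exact_mod_cast hsU)
      have hL := LSeries_hasDerivAt habs
      have hFev : F =ᶠ[𝓝 s] fun z => Complex.exp (LSeries a z) :=
        Filter.eventually_of_mem ((isOpen_ball.inter hU).mem_nhds ⟨(hball hs.1).1, hsU⟩)
          fun z hz => heq z hz.1 hz.2
      have hFd : HasDerivAt F (Complex.exp (LSeries a s) * -LSeries (logMul a) s) s :=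
        hL.cexp.congr_of_eventuallyEq hFev
      have hlog := hFd.clog (hball hs.1).2
      rw [hlog.deriv, hL.deriv, heq s (hball hs.1).1 hsU]
      exact mul_div_cancel_left₀ _ (Complex.exp_ne_zero _)
    have h0 : Complex.log (F ((x + δ / 2 : ℝ) : ℂ)) = LSeries a ((x + δ / 2 : ℝ) : ℂ) := by
      rw [heq _ (hball hσ₀.1).1 hσ₀.2]
      have him : (LSeries a ((x + δ / 2 : ℝ) : ℂ)).im = 0 :=
        ((Complex.le_def.mp (hnonneg (x + δ / 2))).2).symm
      exact Complex.log_exp (by rw [him]; exact neg_lt_zero.mpr Real.pi_pos)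
        (by rw [him]; exact Real.pi_pos.le)
    intro s hs hsx
    exact hVo.eqOn_of_deriv_eq hVc (hh.mono Set.inter_subset_left)
      (hLan.differentiableOn.mono fun z hz => hz.2) hderivEq hσ₀ h0 ⟨hs, hsx⟩
  -- (5) the disc form of Landau's theorem
  exact abscissaOfAbsConv_lt_of_differentiableOn_ball ha hδ hax hh hagree

/-- **Landau's theorem, real-axis form.** Let `a n ≥ 0` with finite abscissa
(`abscissaOfAbsConv a ≤ x₀`). Suppose that for every real `c > y` with `abscissaOfAbsConv a ≤ c`
there are `ε > 0` and a function `F` holomorphic on the disc `|s - c| < ε` with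
`F s = exp (LSeries a s)` for `s` in the disc with `re s > c`. Then `abscissaOfAbsConv a ≤ y`:
otherwise the abscissa is a real number `c > y`, to which the hypothesis and the exponential disc
form `abscissaOfAbsConv_lt_of_exp_eq_on_ball` apply. Only neighbourhoods of real points enter.
[cite: MontgomeryVaughan2007, §1.2, Thm. 1.7] -/
theorem abscissaOfAbsConv_le_of_exp_eq_nhds {a : ℕ → ℂ} (ha : 0 ≤ a) {x₀ y : ℝ}
    (hax : abscissaOfAbsConv a ≤ x₀)
    (h : ∀ c : ℝ, y < c → abscissaOfAbsConv a ≤ c → ∃ ε > 0, ∃ F : ℂ → ℂ,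
      DifferentiableOn ℂ F (ball (c : ℂ) ε) ∧
        ∀ s ∈ ball (c : ℂ) ε, c < s.re → F s = Complex.exp (LSeries a s)) :
    abscissaOfAbsConv a ≤ y := by
  by_contra! hlt
  have htop : abscissaOfAbsConv a ≠ ⊤ := ne_top_of_le_ne_top (EReal.coe_ne_top x₀) hax
  have hbot : abscissaOfAbsConv a ≠ ⊥ := ne_bot_of_gt hlt
  set c : ℝ := (abscissaOfAbsConv a).toReal with hc
  have hac : abscissaOfAbsConv a = c := (EReal.coe_toReal htop hbot).symm
  rw [hac] at hlt
  have hyc : y < c := by exact_mod_cast hlt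
  obtain ⟨ε, hε, F, hF, heq⟩ := h c hyc hac.le
  have := abscissaOfAbsConv_lt_of_exp_eq_on_ball ha hε hac.le hF heq
  rw [hac] at this
  exact lt_irrefl _ this

/-- **Landau's theorem, quotient form.** Let `a n ≥ 0` with `abscissaOfAbsConv a ≤ x₀`. Suppose
that for every real `σ₀ > y` there are functions `I`, `A` holomorphic on the half-plane `re s > y`
with `A σ₀ ≠ 0` and `I s = A s · exp (LSeries a s)` whenever `re s > y` and `re s > x₀`. Then the
series converges absolutely on `re s > y` (`abscissaOfAbsConv a ≤ y`). Proof: at a real `c > y`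
bounding the abscissa, `I = A · exp (LSeries a)` holds on the whole half-plane `re s > c` by the
identity theorem, and `A ≠ 0` on a small disc about `c`, where `I / A` is the holomorphic function
asked for by the real-axis form `abscissaOfAbsConv_le_of_exp_eq_nhds`. This is the step "hence
`L_S = Ψ / A` is holomorphic at `s₀`" of Jacquet–Shalika (1981), proof of Lemma (5.2), p. 555,
with `s₀` restricted to real points. [cite: MontgomeryVaughan2007, §1.2, Thm. 1.7] -/
theorem abscissaOfAbsConv_le_of_exp_quotient {a : ℕ → ℂ} (ha : 0 ≤ a) {x₀ y : ℝ}
    (hax : abscissaOfAbsConv a ≤ x₀)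
    (h : ∀ σ₀ : ℝ, y < σ₀ → ∃ I A : ℂ → ℂ, DifferentiableOn ℂ I {s : ℂ | y < s.re} ∧
      DifferentiableOn ℂ A {s : ℂ | y < s.re} ∧ A σ₀ ≠ 0 ∧
        ∀ s : ℂ, y < s.re → x₀ < s.re → I s = A s * Complex.exp (LSeries a s)) :
    abscissaOfAbsConv a ≤ y := by
  refine abscissaOfAbsConv_le_of_exp_eq_nhds ha hax fun c hyc hac => ?_
  obtain ⟨I, A, hI, hA, hA0, hIA⟩ := h c hyc
  have hY : IsOpen {s : ℂ | y < s.re} := isOpen_lt continuous_const continuous_re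
  have hU : IsOpen {s : ℂ | c < s.re} := isOpen_lt continuous_const continuous_re
  have hUY : {s : ℂ | c < s.re} ⊆ {s : ℂ | y < s.re} := fun s (hs : c < s.re) =>
    show y < s.re from hyc.trans hs
  -- (1) `I = A * exp ∘ LSeries a` on the half-plane `re s > c` (identity theorem)
  have hIan : AnalyticOnNhd ℂ I {s : ℂ | c < s.re} := (hI.mono hUY).analyticOnNhd hU
  have hLan : AnalyticOnNhd ℂ (LSeries a) {s : ℂ | c < s.re} :=
    (LSeries_analyticOnNhd a).mono fun s (hs : c < s.re) =>
      show abscissaOfAbsConv a < s.re from hac.trans_lt (by exact_mod_cast hs)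
  have hPan : AnalyticOnNhd ℂ (fun s => A s * Complex.exp (LSeries a s)) {s : ℂ | c < s.re} :=
    ((hA.mono hUY).analyticOnNhd hU).mul fun s hs => (hLan s hs).cexp
  have hz₀ : ((max x₀ c + 1 : ℝ) : ℂ) ∈ {s : ℂ | c < s.re} := by
    show c < ((max x₀ c + 1 : ℝ) : ℂ).re
    rw [ofReal_re]
    linarith [le_max_right x₀ c]
  have hev : I =ᶠ[𝓝 ((max x₀ c + 1 : ℝ) : ℂ)] fun s => A s * Complex.exp (LSeries a s) := by
    have hV : IsOpen {s : ℂ | max x₀ c < s.re} := isOpen_lt continuous_const continuous_re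
    refine Filter.eventually_of_mem (hV.mem_nhds ?_) fun s (hs : max x₀ c < s.re) =>
      hIA s (hyc.trans ((le_max_right x₀ c).trans_lt hs)) ((le_max_left x₀ c).trans_lt hs)
    show max x₀ c < ((max x₀ c + 1 : ℝ) : ℂ).re
    rw [ofReal_re]; linarith
  have hEq : Set.EqOn I (fun s => A s * Complex.exp (LSeries a s)) {s : ℂ | c < s.re} :=
    hIan.eqOn_of_preconnected_of_eventuallyEq hPan (convex_halfSpace_re_gt c).isPreconnected
      hz₀ hev
  -- (2) a disc about `c` inside `re s > y` on which `A ≠ 0`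
  have hcY : (c : ℂ) ∈ {s : ℂ | y < s.re} := by
    show y < (c : ℂ).re
    rwa [ofReal_re]
  have hAcont : ContinuousAt A c := (hA.differentiableAt (hY.mem_nhds hcY)).continuousAt
  obtain ⟨ε, hε, hball⟩ : ∃ ε > 0, ball (c : ℂ) ε ⊆ {s : ℂ | y < s.re} ∩ A ⁻¹' {w | w ≠ 0} :=
    Metric.mem_nhds_iff.mp (Filter.inter_mem (hY.mem_nhds hcY)
      (hAcont.preimage_mem_nhds (isOpen_ne.mem_nhds hA0)))
  -- (3) the quotient `I / A` on that disc
  refine ⟨ε, hε, fun s => I s / A s, ?_, fun s hs hsc => ?_⟩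
  · exact ((hI.mono fun s hs => (hball hs).1).div (hA.mono fun s hs => (hball hs).1)
      fun s hs => (hball hs).2)
  · have hAs : A s ≠ 0 := (hball hs).2
    show I s / A s = Complex.exp (LSeries a s)
    rw [hEq (show c < s.re from hsc), mul_div_cancel_left₀ _ hAs]

end Literature.NumberTheory.LFunctions.Landau
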